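import Summits.AnomalousDissipation.AnomalousDissipation.Theorems.SolenoidalFractalHomogenisationLagrangianStepOddNonExpansion
import Summits.AnomalousDissipation.AnomalousDissipation.Theorems.IsotropicCubatureWord
import Mathlib.Algebra.QuadraticDiscriminant
import Literature.Analysis.FluidPDE.FiniteFourierModeEulerVec
import HarnessLib

/-!
# The STRICT reversed-Minkowski inequality for transverse line forms, in Gram form (p5's (L4) odd-gain certificate, ELEMENTARY) (K1L_D helper)

Helper file of route `SolenoidalFractalHomogenisation`, crux K1L_D `LagrangianRenormalisationStepDesign` (stmt-AnomalousDissipation-27980),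
registered stub `stub_cellLawV0_IS` (W5 sectorial window, ODD half `SectorialOddChannelBoundOn … κ ε τ₀`, `κ < 1`).  Planner ad-ideate-p5's
certificate chain (`Cruxes/LagrangianRenormalisationStep/OddGainCertificateSketch.lean`, (L0)–(L5)) reduces the contraction factor `κ = γ` of the
Kato sector under the quasi-static excess map to ONE finite-dimensional inequality, (L4) `MinkowskiDefectCert c γ`: a reversed Minkowski
inequality `Σ_i w_i √det A_i ≤ γ·√det(Σ_i w_i A_i)` with `γ < 1` for the compressions `A_i` to the output plane `κ⊥` of positive line forms whose
transverse spectra lie in a common box `[y, c·y]`.  Gen 7 certified it NUMERICALLY (interval branch-and-bound, kit j309739: `(c, γ) = (1.5, .795),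
(2, .86), (2.6, .91), (3, .935), (4, .975)`); the cell's route of record for the Lean text was "equality case + compactness".

THIS FILE replaces both by an ELEMENTARY KERNEL THEOREM with an explicit constant, in the GRAM FORM that composes directly with the landed
non-expansion argument (`…LagrangianStepOddNonExpansion`, p644915: `intro κ p q`, `bsymb_excQS`, per-slot sector data on the pair `(p, q)`):

* `gram2 M p q = (pᵀMp)(qᵀMq) − ((pᵀMq + qᵀMp)/2)²` — the Gram determinant of the symmetrised form of `M` on the pair `(p, q)`;
* `det_mono_two` — `2×2` determinant monotonicity `0 ≤ A ≤ A + D ⇒ det A ≤ det (A + D)` on Gram data;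
* `gram2_perpMat_eq` — for a unit normal `n`, a unit output direction `κ` and `p, q ⊥ κ`:
  `gram2 (1 − n nᵀ) p q = (n·κ)² · ((p·p)(q·q) − (p·q)²)` (the squared cosine between the planes `n⊥` and `κ⊥`; vector algebra only);
* **`strictMinkowski_gram`** — for weights `w_i ≥ 0`, unit normals `n_i`, response matrices `M_i` with `y·|P_{n_i}x|² ≤ xᵀM_ix ≤ c·y·|P_{n_i}x|²`,
  a lower frame constant `a` (`Σ_i w_i |P_{n_i} v|² ≥ a|v|²` on `κ⊥`) and `B ≥ Σ_i w_i |n_i·κ|`: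
  `∀ p q ⊥ κ,  Σ_i w_i √(gram2 M_i p q) ≤ (c·B/a) · √(gram2 (Σ_i w_i • M_i) p q)`.

§2 instantiates it for the 13-line / 26-slot cubature system `cubatureWord` (weights `slotW κ s = c_s(e_s·κ)²` and normals `slotN s = m̂_s`
of `bsymb_excQS`): `a = c₀` (`slotW_perpSq_sum`, an EQUALITY — isotropy in transverse-projector form, design identity `slotTermP_sum`) and
`B ≤ c₀·√5/3` (`slotW_abs_sum_le`: AM–GM `2√5|μ| ≤ 5μ² + 1` slot by slot + design identity `slotTermB_sum`, i.e. the moments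
`Σ w = 280f`, `Σ wμ² = 56f`, `c₀ = 168f`, `f = 1/(119040π⁴)`), whence **`strictMinkowski_cubatureWord`** with the explicit factor
`γ(c) = c·√5/3`, `< 1` for every box ratio `c < 3/√5 ≈ 1.3416` (`gamma_lt_one`) — no numerics, no compactness.  (The sharp constant is
`γ₀ = max_κ Σ_s w_s|m̂_s·κ|/c₀ = 0.65497`, i.e. `c < 1.527`; `√5/3 = 0.745` is the Cauchy–Schwarz relaxation.)  DESIGN READ-OFF for the
tenure / `stub_cellLawV0_IS`: `∃ ΛV > 1` is existential — take `ΛV ≤ 1.15`, so that the box ratio `c = (hi/lo)` of the per-slot transverse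
response over the window stays `< 3/√5`.
No named facts, no sorry.  NOT a proof of the stub, of the crux, of Onsager's conjecture or of anomalous dissipation — rung-leaf F-D1.A0 algebra.
Planner seat `ad-ideate-p5` g8 (lens «profile»), 2026-08-28; Theorems-ready text for a prover lander.
-/

set_option linter.dupNamespace false
set_option linter.style.longLine false

noncomputable section

namespace Summit.AnomalousDissipation.AnomalousDissipation.Theorems.SolenoidalFractalHomogenisation.LagrangianStep.OddGain

open Matrix Finset
open Literature.Analysis.FluidPDE.KY (real_dot_eq)

/-! ## Vocabulary -/

/-- Gram determinant of the symmetrised bilinear form of `M` on the pair `(p, q)`. -/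
def gram2 (M : Matrix (Fin 3) (Fin 3) ℝ) (p q : Fin 3 → ℝ) : ℝ :=
  (p ⬝ᵥ M *ᵥ p) * (q ⬝ᵥ M *ᵥ q) - ((p ⬝ᵥ M *ᵥ q + q ⬝ᵥ M *ᵥ p) / 2) ^ 2

/-- The transverse form `1 − n nᵀ` of a (unit) normal `n`. -/
def perpMat (n : Fin 3 → ℝ) : Matrix (Fin 3) (Fin 3) ℝ := 1 - Matrix.vecMulVec n n

/-- `|P_n x|² = |x|² − (n·x)²` for a unit normal `n`. -/
def perpSq (n x : Fin 3 → ℝ) : ℝ := x ⬝ᵥ x - (n ⬝ᵥ x) ^ 2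

/-- cross product in coordinates (local copy; only its coordinate formula is used). -/
def cross3 (p q : Fin 3 → ℝ) : Fin 3 → ℝ :=
  ![p 1 * q 2 - p 2 * q 1, p 2 * q 0 - p 0 * q 2, p 0 * q 1 - p 1 * q 0]

/-! ## Coordinate expansions -/

-- `real_dot_eq` of the source = `Literature.Analysis.FluidPDE.KY.real_dot_eq` (FiniteFourierModeEulerVec; dedup.landed)

/-- `form_fin_three` (p5 g8, OddGainDefect §1; see the file header). -/
theorem form_fin_three (M : Matrix (Fin 3) (Fin 3) ℝ) (x y : Fin 3 → ℝ) :
    x ⬝ᵥ M *ᵥ y = x 0 * (M 0 0 * y 0 + M 0 1 * y 1 + M 0 2 * y 2) + x 1 * (M 1 0 * y 0 + M 1 1 * y 1 + M 1 2 * y 2)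
      + x 2 * (M 2 0 * y 0 + M 2 1 * y 1 + M 2 2 * y 2) := by
  simp [dotProduct, Matrix.mulVec, Fin.sum_univ_three]

/-- The bilinear form of `1 − n nᵀ`. [folklore] -/
theorem form_perpMat (n x y : Fin 3 → ℝ) : x ⬝ᵥ (perpMat n) *ᵥ y = x ⬝ᵥ y - (n ⬝ᵥ x) * (n ⬝ᵥ y) := by
  rw [perpMat, form_fin_three, real_dot_eq, real_dot_eq, real_dot_eq]
  simp [Matrix.sub_apply, Matrix.vecMulVec_apply, Matrix.one_apply_eq, Matrix.one_apply_ne]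
  ring

/-- `form_perpMat_self` (p5 g8, OddGainDefect §1; see the file header). -/
theorem form_perpMat_self (n x : Fin 3 → ℝ) : x ⬝ᵥ (perpMat n) *ᵥ x = perpSq n x := by
  rw [form_perpMat, perpSq, sq]

/-- bilinear expansion of a quadratic form at `p + t q`. [folklore] -/
theorem form_add_smul (M : Matrix (Fin 3) (Fin 3) ℝ) (p q : Fin 3 → ℝ) (t : ℝ) :
    (p + t • q) ⬝ᵥ M *ᵥ (p + t • q) = (q ⬝ᵥ M *ᵥ q) * (t * t) + (p ⬝ᵥ M *ᵥ q + q ⬝ᵥ M *ᵥ p) * t + p ⬝ᵥ M *ᵥ p := by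
  simp only [Matrix.mulVec_add, Matrix.mulVec_smul, dotProduct_add, add_dotProduct, dotProduct_smul, smul_dotProduct, smul_eq_mul]
  ring

/-- the form of a difference `c • A − B`. [folklore] -/
theorem form_smul_sub (c : ℝ) (A B : Matrix (Fin 3) (Fin 3) ℝ) (x y : Fin 3 → ℝ) :
    x ⬝ᵥ (c • A - B) *ᵥ y = c * (x ⬝ᵥ A *ᵥ y) - x ⬝ᵥ B *ᵥ y := by
  rw [Matrix.sub_mulVec, Matrix.smul_mulVec, dotProduct_sub, dotProduct_smul, smul_eq_mul]

/-- the form of a weighted sum. [folklore] -/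
theorem form_sum {ι : Type*} (s : Finset ι) (w : ι → ℝ) (M : ι → Matrix (Fin 3) (Fin 3) ℝ) (x y : Fin 3 → ℝ) :
    x ⬝ᵥ (∑ i ∈ s, w i • M i) *ᵥ y = ∑ i ∈ s, w i * (x ⬝ᵥ (M i) *ᵥ y) := by
  rw [Matrix.sum_mulVec, dotProduct_sum]
  refine Finset.sum_congr rfl fun i _ => ?_
  rw [Matrix.smul_mulVec, dotProduct_smul, smul_eq_mul]

/-- `gram2` scales quadratically. [folklore] -/
theorem gram2_smul (c : ℝ) (M : Matrix (Fin 3) (Fin 3) ℝ) (p q : Fin 3 → ℝ) :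
    gram2 (c • M) p q = c ^ 2 * gram2 M p q := by
  simp only [gram2, Matrix.smul_mulVec, dotProduct_smul, smul_eq_mul]
  ring

/-! ## `2×2` positive-semidefinite data and determinant monotonicity -/

/-- PSD Gram data of a form that is nonnegative along the line `p + t q` and at `q`. [folklore] -/
theorem psd_data (D : Matrix (Fin 3) (Fin 3) ℝ) (p q : Fin 3 → ℝ) (hpt : ∀ t : ℝ, 0 ≤ (p + t • q) ⬝ᵥ D *ᵥ (p + t • q))
    (hq : 0 ≤ q ⬝ᵥ D *ᵥ q) :
    0 ≤ p ⬝ᵥ D *ᵥ p ∧ 0 ≤ q ⬝ᵥ D *ᵥ q ∧ ((p ⬝ᵥ D *ᵥ q + q ⬝ᵥ D *ᵥ p) / 2) ^ 2 ≤ (p ⬝ᵥ D *ᵥ p) * (q ⬝ᵥ D *ᵥ q) := by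
  have h0 : 0 ≤ p ⬝ᵥ D *ᵥ p := by simpa using hpt 0
  refine ⟨h0, hq, ?_⟩
  have h' : ∀ t : ℝ, 0 ≤ (q ⬝ᵥ D *ᵥ q) * (t * t) + (p ⬝ᵥ D *ᵥ q + q ⬝ᵥ D *ᵥ p) * t + p ⬝ᵥ D *ᵥ p := by
    intro t; rw [← form_add_smul]; exact hpt t
  have hd := discrim_le_zero h'
  rw [discrim] at hd
  nlinarith [hd]

/-- **`2×2` determinant monotonicity on Gram data**: if `A = (a₁₁, a₁₂, a₂₂)` and `D = (d₁₁, d₁₂, d₂₂)` are positive semidefinite then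
`det A ≤ det (A + D)`. [folklore] -/
theorem det_mono_two {a11 a12 a22 d11 d12 d22 : ℝ} (ha11 : 0 ≤ a11) (ha22 : 0 ≤ a22) (ha : a12 ^ 2 ≤ a11 * a22)
    (hd11 : 0 ≤ d11) (hd22 : 0 ≤ d22) (hd : d12 ^ 2 ≤ d11 * d22) :
    a11 * a22 - a12 ^ 2 ≤ (a11 + d11) * (a22 + d22) - (a12 + d12) ^ 2 := by
  have hprod : a12 ^ 2 * d12 ^ 2 ≤ (a11 * a22) * (d11 * d22) := mul_le_mul ha hd (sq_nonneg _) (mul_nonneg ha11 ha22)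
  have h1 : (2 * (a12 * d12)) ^ 2 ≤ (a11 * d22 + a22 * d11) ^ 2 := by
    nlinarith [hprod, sq_nonneg (a11 * d22 - a22 * d11)]
  have hnn : 0 ≤ a11 * d22 + a22 * d11 := by positivity
  have h2 : 2 * (a12 * d12) ≤ a11 * d22 + a22 * d11 := (le_abs_self _).trans (abs_le_of_sq_le_sq h1 hnn)
  nlinarith [h2, hd]

/-! ## Vector algebra: the compression factor `(n·κ)²` -/

/-- Lagrange's identity `|p|²|q|² − (p·q)² = |p × q|²`. [folklore] -/
theorem lagrange_fin_three (p q : Fin 3 → ℝ) :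
    (p ⬝ᵥ p) * (q ⬝ᵥ q) - (p ⬝ᵥ q) ^ 2 = cross3 p q ⬝ᵥ cross3 p q := by
  simp only [real_dot_eq, cross3, Matrix.cons_val_zero, Matrix.cons_val_one, Matrix.cons_val_two, Matrix.head_cons,
    Matrix.tail_cons]
  ring

/-- `gram2 (1 − nnᵀ) p q = (1 − |n|²)|p × q|² + (n·(p × q))²` (pure identity; at `|n| = 1` the first term drops). [folklore] -/
theorem gram2_perpMat_cross (n p q : Fin 3 → ℝ) :
    gram2 (perpMat n) p q = (1 - n ⬝ᵥ n) * (cross3 p q ⬝ᵥ cross3 p q) + (n ⬝ᵥ cross3 p q) ^ 2 := by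
  rw [gram2, form_perpMat, form_perpMat, form_perpMat, form_perpMat]
  simp only [real_dot_eq, cross3, Matrix.cons_val_zero, Matrix.cons_val_one, Matrix.cons_val_two,
    Matrix.head_cons, Matrix.tail_cons]
  ring

/-- For a unit `κ` and `p, q ⊥ κ`, `p × q = ((p × q)·κ) κ` (coordinatewise). [folklore] -/
theorem cross3_eq_smul (κ p q : Fin 3 → ℝ) (hκ : κ ⬝ᵥ κ = 1) (hp : p ⬝ᵥ κ = 0) (hq : q ⬝ᵥ κ = 0) (a : Fin 3) :
    cross3 p q a = (cross3 p q ⬝ᵥ κ) * κ a := by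
  rw [real_dot_eq] at hκ hp hq ⊢
  fin_cases a <;>
  simp only [cross3, Matrix.cons_val_zero, Matrix.cons_val_one, Matrix.cons_val_two, Matrix.head_cons, Matrix.tail_cons,
    Fin.zero_eta, Fin.mk_one, Fin.reduceFinMk]
  · linear_combination (-(p 1 * q 2 - p 2 * q 1)) * hκ + (p 1 * κ 2 - p 2 * κ 1) * hq - (q 1 * κ 2 - q 2 * κ 1) * hp
  · linear_combination (-(p 2 * q 0 - p 0 * q 2)) * hκ + (p 2 * κ 0 - p 0 * κ 2) * hq - (q 2 * κ 0 - q 0 * κ 2) * hp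
  · linear_combination (-(p 0 * q 1 - p 1 * q 0)) * hκ + (p 0 * κ 1 - p 1 * κ 0) * hq - (q 0 * κ 1 - q 1 * κ 0) * hp

/-- **The compression factor**: for a unit normal `n`, a unit `κ` and `p, q ⊥ κ`,
`gram2 (1 − nnᵀ) p q = (n·κ)² · (|p|²|q|² − (p·q)²)`. [folklore] -/
theorem gram2_perpMat_eq (n κ p q : Fin 3 → ℝ) (hn : n ⬝ᵥ n = 1) (hκ : κ ⬝ᵥ κ = 1) (hp : p ⬝ᵥ κ = 0) (hq : q ⬝ᵥ κ = 0) :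
    gram2 (perpMat n) p q = (n ⬝ᵥ κ) ^ 2 * ((p ⬝ᵥ p) * (q ⬝ᵥ q) - (p ⬝ᵥ q) ^ 2) := by
  have h0 := cross3_eq_smul κ p q hκ hp hq 0
  have h1 := cross3_eq_smul κ p q hκ hp hq 1
  have h2 := cross3_eq_smul κ p q hκ hp hq 2
  set W := cross3 p q ⬝ᵥ κ with hW
  have hnw : n ⬝ᵥ cross3 p q = W * (n ⬝ᵥ κ) := by
    rw [real_dot_eq, real_dot_eq n κ]
    linear_combination n 0 * h0 + n 1 * h1 + n 2 * h2
  have hww : cross3 p q ⬝ᵥ cross3 p q = W ^ 2 := by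
    rw [real_dot_eq] at hκ
    rw [real_dot_eq]
    linear_combination (cross3 p q 0 + W * κ 0) * h0 + (cross3 p q 1 + W * κ 1) * h1 + (cross3 p q 2 + W * κ 2) * h2 + W ^ 2 * hκ
  rw [gram2_perpMat_cross, lagrange_fin_three, hn, hnw, hww]
  ring

/-! ## The strict reversed-Minkowski inequality -/

/-- `|P_n x|² ≥ 0` for a unit `n` (Cauchy–Schwarz). [folklore] -/
theorem perpSq_nonneg (n x : Fin 3 → ℝ) (hn : n ⬝ᵥ n = 1) : 0 ≤ perpSq n x := by
  rw [perpSq, real_dot_eq, real_dot_eq]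
  rw [real_dot_eq] at hn
  nlinarith [sq_nonneg (x 0 - (n 0 * x 0 + n 1 * x 1 + n 2 * x 2) * n 0), sq_nonneg (x 1 - (n 0 * x 0 + n 1 * x 1 + n 2 * x 2) * n 1),
    sq_nonneg (x 2 - (n 0 * x 0 + n 1 * x 1 + n 2 * x 2) * n 2)]

/-- PER LINE: a response matrix in the window `y|P_n x|² ≤ xᵀMx ≤ c·y·|P_n x|²` has `gram2 M p q ≤ (c y)²·(n·κ)²·(|p|²|q|² − (p·q)²)` for
`p, q ⊥ κ`. [folklore] -/
theorem gram2_le_line (M : Matrix (Fin 3) (Fin 3) ℝ) (n κ p q : Fin 3 → ℝ) {y c : ℝ} (hy : 0 ≤ y)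
    (hn : n ⬝ᵥ n = 1) (hκ : κ ⬝ᵥ κ = 1) (hp : p ⬝ᵥ κ = 0) (hq : q ⬝ᵥ κ = 0)
    (hwin : ∀ x, y * perpSq n x ≤ x ⬝ᵥ M *ᵥ x ∧ x ⬝ᵥ M *ᵥ x ≤ c * y * perpSq n x) :
    gram2 M p q ≤ (c * y) ^ 2 * ((n ⬝ᵥ κ) ^ 2 * ((p ⬝ᵥ p) * (q ⬝ᵥ q) - (p ⬝ᵥ q) ^ 2)) := by
  -- PSD data of `M` and of `D = (c y)•(1 − nnᵀ) − M`
  have hMnn : ∀ x, 0 ≤ x ⬝ᵥ M *ᵥ x := fun x => le_trans (mul_nonneg hy (perpSq_nonneg n x hn)) (hwin x).1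
  have hDnn : ∀ x, 0 ≤ x ⬝ᵥ ((c * y) • perpMat n - M) *ᵥ x := by
    intro x; rw [form_smul_sub, form_perpMat_self]; linarith [(hwin x).2]
  obtain ⟨a11, a22, a12⟩ := psd_data M p q (fun t => hMnn _) (hMnn q)
  obtain ⟨d11, d22, d12⟩ := psd_data ((c * y) • perpMat n - M) p q (fun t => hDnn _) (hDnn q)
  have key := det_mono_two a11 a22 a12 d11 d22 d12
  -- `A + D` is the Gram data of `(c y)•(1 − nnᵀ)`
  rw [form_smul_sub, form_smul_sub, form_smul_sub, form_smul_sub] at key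
  rw [← gram2_perpMat_eq n κ p q hn hκ hp hq, ← gram2_smul]
  unfold gram2
  simp only [Matrix.smul_mulVec, dotProduct_smul, smul_eq_mul]
  nlinarith [key]

/-- THE SUM: the Gram determinant of `Σ_i w_i M_i` on `p, q ⊥ κ` is at least `(a y)²·(|p|²|q|² − (p·q)²)`. [folklore] -/
theorem gram2_sum_ge {ι : Type*} (s : Finset ι) (w : ι → ℝ) (n : ι → Fin 3 → ℝ) (M : ι → Matrix (Fin 3) (Fin 3) ℝ)
    (κ p q : Fin 3 → ℝ) {y a : ℝ} (hy : 0 ≤ y) (ha : 0 ≤ a) (hw : ∀ i ∈ s, 0 ≤ w i)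
    (hp : p ⬝ᵥ κ = 0) (hq : q ⬝ᵥ κ = 0)
    (hwin : ∀ i ∈ s, ∀ x, y * perpSq (n i) x ≤ x ⬝ᵥ (M i) *ᵥ x)
    (hiso : ∀ v, v ⬝ᵥ κ = 0 → a * (v ⬝ᵥ v) ≤ ∑ i ∈ s, w i * perpSq (n i) v) :
    (a * y) ^ 2 * ((p ⬝ᵥ p) * (q ⬝ᵥ q) - (p ⬝ᵥ q) ^ 2) ≤ gram2 (∑ i ∈ s, w i • M i) p q := by
  -- `D = G − (a y)•1` is nonnegative on `κ⊥`
  have hG : ∀ x, x ⬝ᵥ κ = 0 → (a * y) * (x ⬝ᵥ x) ≤ x ⬝ᵥ (∑ i ∈ s, w i • M i) *ᵥ x := by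
    intro x hx
    rw [form_sum]
    calc (a * y) * (x ⬝ᵥ x) = y * (a * (x ⬝ᵥ x)) := by ring
      _ ≤ y * ∑ i ∈ s, w i * perpSq (n i) x := mul_le_mul_of_nonneg_left (hiso x hx) hy
      _ = ∑ i ∈ s, w i * (y * perpSq (n i) x) := by rw [Finset.mul_sum]; exact Finset.sum_congr rfl fun i _ => by ring
      _ ≤ ∑ i ∈ s, w i * (x ⬝ᵥ (M i) *ᵥ x) := Finset.sum_le_sum fun i hi => mul_le_mul_of_nonneg_left (hwin i hi x) (hw i hi)
  have hDnn : ∀ x, x ⬝ᵥ κ = 0 → 0 ≤ x ⬝ᵥ ((∑ i ∈ s, w i • M i) - (a * y) • (1 : Matrix (Fin 3) (Fin 3) ℝ)) *ᵥ x := by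
    intro x hx
    rw [Matrix.sub_mulVec, dotProduct_sub, Matrix.smul_mulVec, dotProduct_smul, Matrix.one_mulVec, smul_eq_mul]
    linarith [hG x hx]
  have hperp : ∀ t : ℝ, (p + t • q) ⬝ᵥ κ = 0 := by
    intro t; rw [add_dotProduct, smul_dotProduct, hp, hq, smul_zero, add_zero]
  obtain ⟨d11, d22, d12⟩ := psd_data ((∑ i ∈ s, w i • M i) - (a * y) • (1 : Matrix (Fin 3) (Fin 3) ℝ)) p q
    (fun t => hDnn _ (hperp t)) (hDnn q hq)
  -- PSD data of `(a y)•1`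
  have hω : 0 ≤ (p ⬝ᵥ p) * (q ⬝ᵥ q) - (p ⬝ᵥ q) ^ 2 := by
    rw [lagrange_fin_three, real_dot_eq]
    nlinarith [mul_self_nonneg (cross3 p q 0), mul_self_nonneg (cross3 p q 1), mul_self_nonneg (cross3 p q 2)]
  have hpp : 0 ≤ p ⬝ᵥ p := by rw [real_dot_eq]; nlinarith [mul_self_nonneg (p 0), mul_self_nonneg (p 1), mul_self_nonneg (p 2)]
  have hqq : 0 ≤ q ⬝ᵥ q := by rw [real_dot_eq]; nlinarith [mul_self_nonneg (q 0), mul_self_nonneg (q 1), mul_self_nonneg (q 2)]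
  have hay : 0 ≤ a * y := mul_nonneg ha hy
  have key := det_mono_two (a11 := (a * y) * (p ⬝ᵥ p)) (a12 := (a * y) * (p ⬝ᵥ q)) (a22 := (a * y) * (q ⬝ᵥ q))
    (mul_nonneg hay hpp) (mul_nonneg hay hqq) (by nlinarith [mul_nonneg (mul_nonneg hay hay) hω]) d11 d22 d12
  simp only [Matrix.sub_mulVec, dotProduct_sub, Matrix.smul_mulVec, dotProduct_smul, Matrix.one_mulVec, smul_eq_mul] at key
  unfold gram2
  have hsym : q ⬝ᵥ p = p ⬝ᵥ q := dotProduct_comm q p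
  rw [hsym] at key
  nlinarith [key]

/-- **STRICT REVERSED MINKOWSKI (Gram form)**.  Weights `w_i ≥ 0`, unit normals `n_i`, response matrices `M_i` in the common transverse
window `y|P_{n_i}x|² ≤ xᵀM_ix ≤ c·y·|P_{n_i}x|²` (`y ≥ 0`, `c ≥ 0`), a unit output direction `κ`, a lower frame constant `a > 0` on `κ⊥`
and an upper bound `B` for `Σ_i w_i |n_i·κ|`.  Then for all `p, q ⊥ κ`:
`Σ_i w_i √(gram2 M_i p q) ≤ (c·B/a) · √(gram2 (Σ_i w_i M_i) p q)`.
With `γ := c·B/a < 1` this is the Minkowski DEFECT that makes the Kato sector CONTRACT under the slot sum. [folklore] -/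
theorem strictMinkowski_gram {ι : Type*} (s : Finset ι) (w : ι → ℝ) (n : ι → Fin 3 → ℝ) (M : ι → Matrix (Fin 3) (Fin 3) ℝ)
    (κ p q : Fin 3 → ℝ) {y c a B : ℝ} (hy : 0 ≤ y) (hc : 0 ≤ c) (ha : 0 < a) (hw : ∀ i ∈ s, 0 ≤ w i)
    (hn : ∀ i ∈ s, n i ⬝ᵥ n i = 1) (hκ : κ ⬝ᵥ κ = 1) (hp : p ⬝ᵥ κ = 0) (hq : q ⬝ᵥ κ = 0)
    (hwin : ∀ i ∈ s, ∀ x, y * perpSq (n i) x ≤ x ⬝ᵥ (M i) *ᵥ x ∧ x ⬝ᵥ (M i) *ᵥ x ≤ c * y * perpSq (n i) x)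
    (hiso : ∀ v, v ⬝ᵥ κ = 0 → a * (v ⬝ᵥ v) ≤ ∑ i ∈ s, w i * perpSq (n i) v)
    (hB : ∑ i ∈ s, w i * |n i ⬝ᵥ κ| ≤ B) :
    ∑ i ∈ s, w i * Real.sqrt (gram2 (M i) p q) ≤ (c * B / a) * Real.sqrt (gram2 (∑ i ∈ s, w i • M i) p q) := by
  set ω2 := (p ⬝ᵥ p) * (q ⬝ᵥ q) - (p ⬝ᵥ q) ^ 2 with hω2
  have hω : 0 ≤ ω2 := by
    rw [hω2, lagrange_fin_three, real_dot_eq]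
    nlinarith [mul_self_nonneg (cross3 p q 0), mul_self_nonneg (cross3 p q 1), mul_self_nonneg (cross3 p q 2)]
  have hcy : 0 ≤ c * y := mul_nonneg hc hy
  -- per line
  have hline : ∀ i ∈ s, Real.sqrt (gram2 (M i) p q) ≤ (c * y) * |n i ⬝ᵥ κ| * Real.sqrt ω2 := by
    intro i hi
    have h := gram2_le_line (M i) (n i) κ p q hy (hn i hi) hκ hp hq (hwin i hi)
    calc Real.sqrt (gram2 (M i) p q) ≤ Real.sqrt (((c * y) * |n i ⬝ᵥ κ|) ^ 2 * ω2) := by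
          apply Real.sqrt_le_sqrt; rw [mul_pow, sq_abs]; linarith [h]
      _ = (c * y) * |n i ⬝ᵥ κ| * Real.sqrt ω2 := by
          rw [Real.sqrt_mul (sq_nonneg _), Real.sqrt_sq (mul_nonneg hcy (abs_nonneg _))]
  have hnum : ∑ i ∈ s, w i * Real.sqrt (gram2 (M i) p q) ≤ (c * y) * Real.sqrt ω2 * B := by
    calc ∑ i ∈ s, w i * Real.sqrt (gram2 (M i) p q) ≤ ∑ i ∈ s, w i * ((c * y) * |n i ⬝ᵥ κ| * Real.sqrt ω2) :=
          Finset.sum_le_sum fun i hi => mul_le_mul_of_nonneg_left (hline i hi) (hw i hi)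
      _ = (c * y) * Real.sqrt ω2 * ∑ i ∈ s, w i * |n i ⬝ᵥ κ| := by
          rw [Finset.mul_sum]; exact Finset.sum_congr rfl fun i _ => by ring
      _ ≤ (c * y) * Real.sqrt ω2 * B := mul_le_mul_of_nonneg_left hB (mul_nonneg hcy (Real.sqrt_nonneg _))
  -- the sum
  have hden : (a * y) * Real.sqrt ω2 ≤ Real.sqrt (gram2 (∑ i ∈ s, w i • M i) p q) := by
    have h := gram2_sum_ge s w n M κ p q hy ha.le hw hp hq (fun i hi x => (hwin i hi x).1) hiso
    calc (a * y) * Real.sqrt ω2 = Real.sqrt ((a * y) ^ 2 * ω2) := by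
          rw [Real.sqrt_mul (sq_nonneg _), Real.sqrt_sq (mul_nonneg ha.le hy)]
      _ ≤ Real.sqrt (gram2 (∑ i ∈ s, w i • M i) p q) := Real.sqrt_le_sqrt h
  have hB0 : 0 ≤ B := le_trans (Finset.sum_nonneg fun i hi => mul_nonneg (hw i hi) (abs_nonneg _)) hB
  have hγ : 0 ≤ c * B / a := div_nonneg (mul_nonneg hc hB0) ha.le
  calc ∑ i ∈ s, w i * Real.sqrt (gram2 (M i) p q) ≤ (c * y) * Real.sqrt ω2 * B := hnum
    _ = (c * B / a) * ((a * y) * Real.sqrt ω2) := by field_simp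
    _ ≤ (c * B / a) * Real.sqrt (gram2 (∑ i ∈ s, w i • M i) p q) := mul_le_mul_of_nonneg_left hden hγ


end Summit.AnomalousDissipation.AnomalousDissipation.Theorems.SolenoidalFractalHomogenisation.LagrangianStep.OddGain

end
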